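/-
Copyright (c) 2026 the pub-hodgecm2 formalisation cell (harness21).  New file.
Origin: seat `prover-pub-hodgecm2-own-b01-g12-0` (unit pub-hodgecm2-own-b01 = owner / drafter / filer of the hM DISCHARGE files; sibling of
`CorCM/PortJoin/HMDischarge.lean` ✔ p370229 and `CorCM/PortJoin/ClosedLocal.lean` ✔ p370803), written 2026-08-23 for the VERSION-B END file
`CorCM/PortJoin/ClosedPrinted.lean` (assembler d2bridge-plan, filer d2bridge-end-1): the Δ2 bridge fills the `h418` slot field by field, and its
pins (S1 admissible CM type, the uniform Ω family, the record's App-C datum) are typed at GALOIS CM fields of degree ≥ 6 — exactly the fields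
the END display's `hLiu` / `hD1` quantify over — whereas `hM_of_port`'s `h418` (the ported head's binder VERBATIM) ranges over EVERY CM-field
code `L : HodgeCM.CMField`.  This file offers the same two theorems with `h418` LOCALISED to those fields; nothing else changes.
KERNEL only: theorems; no `def`, no instance, no named fact, no `sorry`; ONE displayed Prop binder in §L1 (`h418`, localised; T5 class n/a);
count-neutral; HC_CM is NOT proved; hM is NOT signed equal — wording is the coordinator's / red team's.
-/
import Summits.HodgeConjecture.HodgeCM.Model.FacePeriodThmF
import Summits.HodgeConjecture.CorCM.PortJoin.HMDischarge
import HarnessLib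

set_option autoImplicit false

/-!
# hM DISCHARGE BY NAME — the `h418` reading LOCALISED to Galois CM fields of degree ≥ 6

`CorCM/PortJoin/HMDischarge.lean` (✔ p370229) proves the END display's meeting binder `hM` (pointer LABEL #7 ✔ p335946 :178–:206) from the
ported package head `HodgeCM.Model.periodThmF_picardCM_of_GRU_thm418C`, whose displayed binder `h418` — the reading r8 `Thm418C` of
[Liu2021 Thm. 4.18] at the pinned dictionary `HodgeCM.Model.liuDictionaryPin` — is quantified over EVERY `L : HodgeCM.CMField`.  The package
APPLIES that binder only at the face field (`HodgeCM/Model/FacePeriodThmF.lean` :133 `periodThmF_r20JBUARM` feeds `periodNV_face_anyEmb_R2J`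
:98 with `h418` at `F` Galois, `6 ≤ [F:ℚ]`), and the `hM` text itself quantifies `∀ F, IsGalois ℚ F → 6 ≤ finrank ℚ F → …`.  Hence:

* §L1 `Model.hM_of_port_local (h418)` — `hM` from the LOCALISED reading `h418 : ∀ F, IsGalois ℚ F → 6 ≤ [F:ℚ] → ∀ {ι₁} V, … →
  (liuDictionaryPin … V …).Thm418C` (binder text = `PortJoin/ClosedLocal.lean` ✔ p370803 :54–:64 VERBATIM): the ported face head
  `HodgeCM.Model.periodNV_face_anyEmb_R2J` (port layer 97) face by face, `hGR…` := the tree theorem `GRConstruction.gru_shape` (✔ p319353)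
  through `HodgeCM.Model.SInstance.GRU.hGR…`, [DeligneMilne1982 Thm. 6.20] proved (`deligneMilne1982_Thm_6_20_full_holds`), then
  `HMDischarge.lean` §1b `hM_rec_of_pkg_periodThmF` at PORT JOIN part 2's `PortJoin.ofPkg_picardCMUniverse` (`rfl`);
* §L2 `Model.hc_cm_of_port_meeting_rec_local (h418) (h) (hLiu) (h21) (hD1) : HC_CM` — the END term of record (pointer #7) at
  `hM := hM_of_port_local h418`; display {h418 (localised), h, hLiu, h21, hD1} (binder texts = `HMDischarge.lean` :286–:321 with `h418` localised);
* §LE `example` — `HMDischarge.lean` §2's global binder restricts to the local one (so §2/§3 there are the special case).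

USE (VERSION-B END file): fill `h418` of §L2 at `(F) (hG) (h6) {ι₁} (V) (hV) (a₀)` by the Δ2 bridge
`D2Bridge.PinSignatures.thm418C_liuDictionaryPin_of_pins …` — Galois-ness and `6 ≤ [F:ℚ]` are now IN SCOPE for the pins.  HC_CM is NOT proved here.
-/

noncomputable section

open scoped TensorProduct InnerProductSpace Kronecker Matrix
open MeasureTheory

namespace Summit.HodgeConjecture.CorCM.Model

open CategoryTheory CategoryTheory.Limits AlgebraicGeometry NumberField
open Literature.AlgebraicGeometry.Motives
open Literature.AlgebraicGeometry.HodgeTheory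
open Literature.AlgebraicGeometry.ShimuraVarieties
open Literature.AlgebraicGeometry.ShimuraVarieties.UnitaryCanonicalModel
open Literature.AlgebraicGeometry.ComplexMultiplication (IsCMTypeRealisation)
open Literature.NumberTheory.ComplexMultiplication
open Literature.NumberTheory.Automorphic
open Literature.NumberTheory.Automorphic.UnitaryGroup (localCharOfCenter)
open Literature.NumberTheory.Automorphic.IdeleClassGroup
open Literature.NumberTheory.Automorphic.PicardCM
open Literature.NumberTheory.Automorphic.Liu2021
open Literature.NumberTheory.Automorphic.Liu2021.AppendixC
open Literature.NumberTheory.Automorphic.Liu2021.AppendixC.RestOne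
open Literature.NumberTheory.Automorphic.Liu2021.Def411WeilCarriers (JW TW isSymm_TW isUnit_det_TW JW_eq JW_apply_ne_zero lineOf)
open Literature.NumberTheory.GelbartRogawski1991 Literature.NumberTheory.GelbartRogawski1991.UnitaryDualPair
open Literature.NumberTheory.GelbartRogawski1991.UnitaryDualPair.WeilCoinv
open Literature.NumberTheory.GelbartRogawski1991.UnitaryDualPair.LocalSplitting (localMu norm_localMu continuous_localMu localMu_toLocalRing_eq_one_iff)
open Literature.NumberTheory.Weil1964 Literature.RepresentationTheory
open Summit.HodgeConjecture.CorCM.Transposition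

section HMDischargeLocal

open Prior.Perl34File (Perl34.IsolationSetting)
open Prior.Perl34File.Perl34

/-! ## §L1  `hM` BY NAME from the LOCALISED reading -/

/-- **§L1 `hM` from the `h418` reading at Galois CM fields of degree ≥ 6 only** (statement = pointer #7 ✔ p335946 :178–:206 VERBATIM; binder
text = `PortJoin/ClosedLocal.lean` :54–:64 VERBATIM): `HMDischarge.lean` §1b `hM_rec_of_pkg_periodThmF` at PORT JOIN part 2's
`PortJoin.ofPkg_picardCMUniverse` (`rfl`, fourth row by proof irrelevance as in §E2 there), the package-side `PeriodThmF` supplied FACE BY FACE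
by the ported head `HodgeCM.Model.periodNV_face_anyEmb_R2J` (`HodgeCM/Model/FacePeriodThmF.lean` :98) exactly as the package's own
`periodThmF_r20JBUARM` :133 does, with `hGR hGR₀ hGR₁ hGR₂ hGR₃` := `GRConstruction.gru_shape` ([GR91 Prop. 3.1.1], tree theorem ✔ p319353)
and `hR` := `deligneMilne1982_Thm_6_20_full_holds`.  `HMDischarge.lean` §2 `hM_of_port` is the special case of a reading granted at every
CM field (§LE).  HC_CM is NOT proved.
[cite: Liu2021, Thm. 4.18 (FJcycle.tex l. 2232–2245)] [cite: GelbartRogawski1991, §3.1 Prop. 3.1.1 p. 455 L1–3]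
[cite: DeligneMilne1982Tannakian, §6 Thm. 6.20 (Riemann), p. 212] -/
theorem hM_of_port_local
    (h418 : ∀ (F : HodgeCM.CMField), IsGalois ℚ F → 6 ≤ Module.finrank ℚ F →
      ∀ {ι₁ : F →+* ℂ} (V : HodgeCM.HermSpace3 F ι₁), (NumberField.InfinitePlace.mk ι₁).embedding = ι₁ →
      ∀ a₀ : HodgeCM.Model.LiuIndex.RealScalar F,
      (HodgeCM.Model.liuDictionaryPin exists_isReal_hodgeModel_holds hodgePQ_independent_of_hodgeModel_holds
          BallQuotient.ballQuotientUniformised_holds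
          (cmAbelianVarietyRealised_of_eigenbasis exists_isReal_hodgeModel_holds hodgePQ_independent_of_hodgeModel_holds
            cmAbelianVarietyEigenbasisRealised_holds)
          Literature.NumberTheory.Transcendental.arapura2012_cor_15_4_6_holds V
          (HodgeCM.Model.LiuIndex.I V (HodgeCM.Model.LiuIndex.repAt a₀) (HodgeCM.Model.LiuIndex.muLiu ι₁ HodgeCM.Model.LiuIndex.GramClass.rep))
          (HodgeCM.Model.LiuIndex.line V (HodgeCM.Model.LiuIndex.repAt a₀)
            (HodgeCM.Model.LiuIndex.muLiu ι₁ HodgeCM.Model.LiuIndex.GramClass.rep))).Thm418C) :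
    let U := picardCMUniverse exists_isReal_hodgeModel_holds hodgePQ_independent_of_hodgeModel_holds
      BallQuotient.ballQuotientUniformised_holds cmAbelianVarietyRealised_holds
    let hU := ballQuotientUniformisedDatum_of BallQuotient.ballQuotientUniformised_holds
    (∀ (F : CMField), IsGalois ℚ F → 6 ≤ Module.finrank ℚ F → ∀ (f : Face F) (ι₁ : F →+* ℂ), f.Admissible ι₁ →
      ∀ V : HermSpace3 F ι₁,
      ∃ (H CG G SK SigIdx SigIdxG : Type) (_ : NormedAddCommGroup H) (_ : InnerProductSpace ℂ H) (_ : CompleteSpace H)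
        (_ : NormedAddCommGroup CG) (_ : NormedSpace ℂ CG) (_ : Group G) (_ : TopologicalSpace G) (_ : TopologicalSpace SK)
        (S : Perl34.IsolationSetting H (Lp ℂ 2 V.autMeasure) CG G SK SigIdx SigIdxG),
        (∀ (Γ : Level V) (ω₁ ω₂ : U.CohC (U.pms F ι₁ V Γ) 1),
          ω₁ ∈ U.Uiso Γ F (f.psi 0) ι₁ → ω₂ ∈ U.Uiso Γ F (f.psi 1) ι₁ →
            embOf exists_isReal_hodgeModel_holds hodgePQ_independent_of_hodgeModel_holds hU cmAbelianVarietyRealised_holds Γ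
                (U.cup2C (U.pms F ι₁ V Γ) 1 ω₁ ω₂) ≠ 0 →
              ∃ u ∈ S.t12.S12,
                ⟪embOf exists_isReal_hodgeModel_holds hodgePQ_independent_of_hodgeModel_holds hU cmAbelianVarietyRealised_holds Γ
                    (U.cup2C (U.pms F ι₁ V Γ) 1 ω₁ ω₂), u⟫_ℂ ≠ 0) ∧
        (∀ χ : S.t34.X, S.t34.allowed χ → ∀ (Φ : SK) (Γ₁ : Level V)
          (ω₁ ω₂ : U.CohC (U.pms F ι₁ V Γ₁) 1),
          ω₁ ∈ U.Uiso Γ₁ F (f.psi 0) ι₁ →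
          ω₂ ∈ U.Uiso Γ₁ F (f.psi 1) ι₁ →
            ⟪embOf exists_isReal_hodgeModel_holds hodgePQ_independent_of_hodgeModel_holds hU cmAbelianVarietyRealised_holds Γ₁
                (U.cup2C (U.pms F ι₁ V Γ₁) 1 ω₁ ω₂),
              S.t34.ϑ χ Φ⟫_ℂ ≠ 0 →
              ∃ (Γ : Level V) (ω : Fin 4 → U.CohC (U.pms F ι₁ V Γ) 1),
                (∀ i, ω i ∈ U.Uiso Γ F (f.psi i) ι₁) ∧
                  ⟪embOf exists_isReal_hodgeModel_holds hodgePQ_independent_of_hodgeModel_holds hU cmAbelianVarietyRealised_holds Γ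
                      (U.cup2C (U.pms F ι₁ V Γ) 1 (ω 2) (ω 3)),
                    embOf exists_isReal_hodgeModel_holds hodgePQ_independent_of_hodgeModel_holds hU cmAbelianVarietyRealised_holds Γ
                      (U.cup2C (U.pms F ι₁ V Γ) 1 (ω 0) (ω 1))⟫_ℂ
                    ≠ 0))
    :=
  hM_rec_of_pkg_periodThmF
    (HodgeCM.Model.picardCMUniverse exists_isReal_hodgeModel_holds hodgePQ_independent_of_hodgeModel_holds
      BallQuotient.ballQuotientUniformised_holds
      (cmAbelianVarietyRealised_of_eigenbasis exists_isReal_hodgeModel_holds hodgePQ_independent_of_hodgeModel_holds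
        cmAbelianVarietyEigenbasisRealised_holds))
    (PortJoin.ofPkg_picardCMUniverse _ _ _ _)
    fun F hG h6 f ι₁ hadm V => by
    haveI : IsGalois ℚ F := hG
    exact HodgeCM.Model.periodNV_face_anyEmb_R2J exists_isReal_hodgeModel_holds hodgePQ_independent_of_hodgeModel_holds
      BallQuotient.ballQuotientUniformised_holds
      (cmAbelianVarietyRealised_of_eigenbasis exists_isReal_hodgeModel_holds hodgePQ_independent_of_hodgeModel_holds
        cmAbelianVarietyEigenbasisRealised_holds)
      Literature.NumberTheory.Transcendental.arapura2012_cor_15_4_6_holds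
      (@HodgeCM.Model.SInstance.GRU.hGR GRConstruction.gru_shape) (@HodgeCM.Model.SInstance.GRU.hGR₀ GRConstruction.gru_shape)
      (@HodgeCM.Model.SInstance.GRU.hGR₁ GRConstruction.gru_shape) (@HodgeCM.Model.SInstance.GRU.hGR₂ GRConstruction.gru_shape)
      (@HodgeCM.Model.SInstance.GRU.hGR₃ GRConstruction.gru_shape) @HodgeCM.Model.ArchSideTerm.muSlotZero
      deligneMilne1982_Thm_6_20_full_holds F h6 f hadm V (h418 F hG h6)

/-! ## §L2  The END term of record at `hM := hM_of_port_local h418` -/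

/-- **§L2 HC_CM from the LOCALISED reading `h418` and the END display's four cites** {`h` [Deligne1979 2.1.2/2.2.5], `hLiu` [Liu2021 Thm. 4.18
as printed at the constructed rest], `h21` [Shimura1998 Thm. 21.4], `hD1` [Liu2021 App. D Lem. D.1, per place]} (binder texts = ✔ p335946
:151–:177 VERBATIM, pointer LABEL #7; `h418` = `PortJoin/ClosedLocal.lean` :54–:64 VERBATIM): one application of
`hc_cm_of_thm418AsPrinted_along_conj_holds_restOne_builtEpiD1_meeting_rec` at `hM := hM_of_port_local h418`.  Every displayed family is now
keyed by a Galois CM field of degree ≥ 6 — the VERSION-B END file fills `h418` here by the Δ2 bridge at those fields.  HC_CM is NOT proved: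
nothing is inhabited here.
[cite: Liu2021, Thm. 4.18 (FJcycle.tex l. 2232–2245)] [cite: Shimura1998, §21.4 Thm. 21.4] [cite: Deligne1979ShimuraVarieties, §2.1.2, 2.2.5 and Cor. 2.7.21] -/
theorem hc_cm_of_port_meeting_rec_local
    (h418 : ∀ (F : HodgeCM.CMField), IsGalois ℚ F → 6 ≤ Module.finrank ℚ F →
      ∀ {ι₁ : F →+* ℂ} (V : HodgeCM.HermSpace3 F ι₁), (NumberField.InfinitePlace.mk ι₁).embedding = ι₁ →
      ∀ a₀ : HodgeCM.Model.LiuIndex.RealScalar F,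
      (HodgeCM.Model.liuDictionaryPin exists_isReal_hodgeModel_holds hodgePQ_independent_of_hodgeModel_holds
          BallQuotient.ballQuotientUniformised_holds
          (cmAbelianVarietyRealised_of_eigenbasis exists_isReal_hodgeModel_holds hodgePQ_independent_of_hodgeModel_holds
            cmAbelianVarietyEigenbasisRealised_holds)
          Literature.NumberTheory.Transcendental.arapura2012_cor_15_4_6_holds V
          (HodgeCM.Model.LiuIndex.I V (HodgeCM.Model.LiuIndex.repAt a₀) (HodgeCM.Model.LiuIndex.muLiu ι₁ HodgeCM.Model.LiuIndex.GramClass.rep))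
          (HodgeCM.Model.LiuIndex.line V (HodgeCM.Model.LiuIndex.repAt a₀)
            (HodgeCM.Model.LiuIndex.muLiu ι₁ HodgeCM.Model.LiuIndex.GramClass.rep))).Thm418C)
    (h : exists_recordSystem)
    (hLiu : ∀ (F : CMField) [IsGalois ℚ F] (h6 : 6 ≤ Module.finrank ℚ F) (Φ : CMType F) (ι₁ : F →+* ℂ), ι₁ ∈ Φ.1 →
      ∀ V : HermSpace3 F ι₁, Thm418AsPrintedC (sec42DataOf h isoOf F ι₁ V Φ)
        (restOne (sec42DataOf h isoOf F ι₁ V Φ) (AlgHom.id ℚ F) ι₁ (isConjugateSymplectic_muOfInvType ι₁ Φ) (hasWeight_one_muOfInvType ι₁ Φ) (Def45.Carriers.ofPolDR (muOfInvType ι₁ Φ) (Def45.PolDR ι₁ (isConjugateSymplectic_muOfInvType ι₁ Φ) (Def45.RMuForm ι₁ (isConjugateSymplectic_muOfInvType ι₁ Φ))))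
            (Def411WeilCarriers.Eps ↥(maximalRealSubfield F) (imagUnitSq F)) (Def411WeilCarriers.epsOf ↥(maximalRealSubfield F) (imagUnitSq F) F (imagUnit F)) (Def411WeilCarriers.Chi ↥(maximalRealSubfield F) F (IsCMField.complexConj F))
            (Def411WeilCarriers.omega ↥(maximalRealSubfield F) F (IsCMField.complexConj F) 3 finProdFinEquiv (Matrix.diagonal V.diagEntries) (complexConj_imagUnit F) (imagUnit_ne_zero F) (imagUnit_mul_self F) (realDiagonal_isSymm F V.diagEntries V.complexConj_diagEntries) (isUnit_det_realDiagonal F V.diagEntries V.complexConj_diagEntries V.diagEntries_ne_zero) (realDiagonal_map F V.diagEntries V.complexConj_diagEntries).symm (OmegaMuSplitting.hsMu F ι₁ V Φ))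
            (Def411WeilCarriers.rho ↥(maximalRealSubfield F) F (IsCMField.complexConj F) 3 finProdFinEquiv (Matrix.diagonal V.diagEntries) (complexConj_imagUnit F) (imagUnit_ne_zero F) (imagUnit_mul_self F) (realDiagonal_isSymm F V.diagEntries V.complexConj_diagEntries) (isUnit_det_realDiagonal F V.diagEntries V.complexConj_diagEntries V.diagEntries_ne_zero) (realDiagonal_map F V.diagEntries V.complexConj_diagEntries).symm (OmegaMuSplitting.hsMu F ι₁ V Φ) V.adelicFinDiag.toMulEquiv.toMonoidHom) ((heckeTranslatesFamilyOf heckeTranslate_definedOver_holds h isoOf F ι₁ V Φ h6).rhoΩOne (AlgHom.id ℚ F) ι₁ (isConjugateSymplectic_muOfInvType ι₁ Φ) (hasWeight_one_muOfInvType ι₁ Φ) (Def45.Carriers.ofPolDR (muOfInvType ι₁ Φ) (Def45.PolDR ι₁ (isConjugateSymplectic_muOfInvType ι₁ Φ) (Def45.RMuForm ι₁ (isConjugateSymplectic_muOfInvType ι₁ Φ)))))))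
    (h21 : shimura1998_thm21_4_casselman)
    (hD1 : ∀ (F : CMField) [IsGalois ℚ F], 6 ≤ Module.finrank ℚ F → ∀ (Φ : CMType F) (ι₁ : F →+* ℂ), ι₁ ∈ Φ.1 →
      ∀ (V : HermSpace3 F ι₁) (ε : Def411WeilCarriers.Eps ↥(maximalRealSubfield F) (imagUnitSq F))
        (χ : Def411WeilCarriers.Chi ↥(maximalRealSubfield F) F (IsCMField.complexConj F)) (v : IsDedekindDomain.HeightOneSpectrum (𝓞 ↥(maximalRealSubfield F))),
        LemD1_1AsPrinted
          (Def411WeilCarriers.localLemD1Data ↥(maximalRealSubfield F) F (IsCMField.complexConj F) 3 finProdFinEquiv (Matrix.diagonal V.diagEntries)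
            (complexConj_imagUnit F) (imagUnit_ne_zero F) (imagUnit_mul_self F) (realDiagonal_isSymm F V.diagEntries V.complexConj_diagEntries)
            (isUnit_det_realDiagonal F V.diagEntries V.complexConj_diagEntries V.diagEntries_ne_zero)
            (realDiagonal_map F V.diagEntries V.complexConj_diagEntries).symm (lineOf ↥(maximalRealSubfield F) (imagUnitSq F) ε)
            (OmegaMuSplitting.muLocalSplittings F ι₁ V Φ (lineOf ↥(maximalRealSubfield F) (imagUnitSq F) ε))
            (le_of_eq (Nat.mul_one 3).symm) (localMu F (OmegaMuSplitting.chiMu F ι₁ Φ))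
            (fun v x => norm_localMu F (OmegaMuSplitting.chiMu F ι₁ Φ) v (OmegaMuSplitting.chiMu_isUnitary F ι₁ Φ) x)
            (continuous_localMu F (OmegaMuSplitting.chiMu F ι₁ Φ))
            (fun v t => localMu_toLocalRing_eq_one_iff F (OmegaMuSplitting.chiMu F ι₁ Φ) v (OmegaMuSplitting.chiMu_isSplittingChar F ι₁ Φ) t)
            χ.1
            (Def411WeilCarriers.norm_chi_eq_one ↥(maximalRealSubfield F) F (IsCMField.complexConj F)
              (Algebra.IsQuadraticExtension.finrank_eq_two ↥(maximalRealSubfield F) F)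
              (UnitaryGroup.algEquiv_ne_one_of_apply_eq_neg ↥(maximalRealSubfield F) F (IsCMField.complexConj F) (complexConj_imagUnit F)
                (imagUnit_ne_zero F)) χ)
            χ.2.1 v)) :
    HC_CM :=
  hc_cm_of_thm418AsPrinted_along_conj_holds_restOne_builtEpiD1_meeting_rec h hLiu h21 hD1 (hM_of_port_local h418)

/-! ## §LE  Shape check (example, no declaration) -/

/-- (LE) `HMDischarge.lean` §2's GLOBAL binder (the ported head's `h418` VERBATIM, every `L : HodgeCM.CMField`) restricts to the LOCAL one:
§2 `hM_of_port` / §3 `hc_cm_of_port_meeting_rec` there are the special case of §L1 / §L2 here. -/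
example
    (h418 : ∀ {L : HodgeCM.CMField} {ι₁ : L →+* ℂ} (V : HodgeCM.HermSpace3 L ι₁),
      (NumberField.InfinitePlace.mk ι₁).embedding = ι₁ → ∀ a₀ : HodgeCM.Model.LiuIndex.RealScalar L,
      (HodgeCM.Model.liuDictionaryPin exists_isReal_hodgeModel_holds hodgePQ_independent_of_hodgeModel_holds
          BallQuotient.ballQuotientUniformised_holds
          (cmAbelianVarietyRealised_of_eigenbasis exists_isReal_hodgeModel_holds hodgePQ_independent_of_hodgeModel_holds
            cmAbelianVarietyEigenbasisRealised_holds)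
          Literature.NumberTheory.Transcendental.arapura2012_cor_15_4_6_holds V
          (HodgeCM.Model.LiuIndex.I V (HodgeCM.Model.LiuIndex.repAt a₀) (HodgeCM.Model.LiuIndex.muLiu ι₁ HodgeCM.Model.LiuIndex.GramClass.rep))
          (HodgeCM.Model.LiuIndex.line V (HodgeCM.Model.LiuIndex.repAt a₀) (HodgeCM.Model.LiuIndex.muLiu ι₁ HodgeCM.Model.LiuIndex.GramClass.rep))).Thm418C) :
    ∀ (F : HodgeCM.CMField), IsGalois ℚ F → 6 ≤ Module.finrank ℚ F →
      ∀ {ι₁ : F →+* ℂ} (V : HodgeCM.HermSpace3 F ι₁), (NumberField.InfinitePlace.mk ι₁).embedding = ι₁ →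
      ∀ a₀ : HodgeCM.Model.LiuIndex.RealScalar F,
      (HodgeCM.Model.liuDictionaryPin exists_isReal_hodgeModel_holds hodgePQ_independent_of_hodgeModel_holds
          BallQuotient.ballQuotientUniformised_holds
          (cmAbelianVarietyRealised_of_eigenbasis exists_isReal_hodgeModel_holds hodgePQ_independent_of_hodgeModel_holds
            cmAbelianVarietyEigenbasisRealised_holds)
          Literature.NumberTheory.Transcendental.arapura2012_cor_15_4_6_holds V
          (HodgeCM.Model.LiuIndex.I V (HodgeCM.Model.LiuIndex.repAt a₀) (HodgeCM.Model.LiuIndex.muLiu ι₁ HodgeCM.Model.LiuIndex.GramClass.rep))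
          (HodgeCM.Model.LiuIndex.line V (HodgeCM.Model.LiuIndex.repAt a₀)
            (HodgeCM.Model.LiuIndex.muLiu ι₁ HodgeCM.Model.LiuIndex.GramClass.rep))).Thm418C :=
  fun _ _ _ _ V hcan a₀ => h418 V hcan a₀

end HMDischargeLocal

end Summit.HodgeConjecture.CorCM.Model

end
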